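import Literature.NumberTheory.LFunctions.Zhang2022.RepairRplus

/-!
# Zhang (2022) §18-margin repair rung, barrier extension (cell landau-siegel §E, slice S-E-p5-1):
# the verdict `¬ (C₂₃₂·C₂₃₃ < |𝔡+𝔡′|²)` on the WIDE class — `ν₂ ≤ ½` and the tie `k₁ = k₃` removed

Trunk T-ANT (NumberTheory/LFunctions). Y. Zhang, *Discrete mean estimates and the Landau–Siegel
zero*, arXiv:2211.02515v1 (2022) [Zhang2022LandauSiegel] — **an unrefereed manuscript under
adjudication. WHAT THIS IS NOT: a claim about its Theorems 1–2, about Landau–Siegel zeros, about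
Parity, or about a repaired `Margin232`; nothing analytic is asserted. The programme SEARCHES and
TYPES; no claim about Landau–Siegel zeros, Theorems 1–2 of arXiv:2211.02515 or a repaired Margin232
until a kernel theorem says so.**

## What is extended, and in which currency

`RepairVerdictAssembly.not_repairable_true_need` (the floor of record; family `familyR` of
`RepairRplus.Rplus`) says: for every design `θ` of the class `R` = `Repair.AdmissibleTheta`
(`ν₃ < ν₂ ≤ ½ = cut₁ < ν₁ < 1`, `ν₁ + ν₃ > 1`, `0 < k₁ = k₃ < 5`, `0 < k₂ < 5`, `ι ∈ ℂ³` free) the joint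
main-order criterion of the §2 endgame fails, `¬ (C232S θ · C233T θ < ‖dSumS θ‖²)`, where the three
functionals OF RECORD are the continued main-term calculus of the manuscript's method on the design's
profiles: `C232S θ = 𝔅(𝔤_θ)` (glued `H`-profile `𝔤_θ = g₁ + R̃g₂`, K-S2), `C233T θ` the (2.33)-side
closed form (`= 𝔅(f_θ)` for the tent `f_θ`, K-S1), `dSumS θ` = formula I on the four `Θ₁`-blocks of
(10.1) (`= P(𝔤_θ, f_θ)`, K-S3).

This file RE-RUNS the dictionary K-S1–K-S3 with two side conditions of `R` deleted — the middle
conjunct `ν₂ ≤ ½` of `Theta.straddleHalf` and the tie `Theta.tiedOuterShifts : k₁ = k₃` — and records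
what the kernel finds (the SURVIVOR AUDIT of the five dictionary hypotheses `hgl`, `hfp`, `h232`,
`h233`, `hsum` of `RepairVerdictAssembly`): **all five survive; no step of the dictionary uses either
deleted conjunct** (nor `cutAtHalf`, nor the upper bounds `k_j < 5`, nor `ν₃ < ½`, nor
`1 < ν₁ + ν₃` beyond `0 < ν₃`). Every identity of the chain (`gluedS_isH1`, `isH1_tentT`,
`C232S_eq_form`, `mainTermForm_tentT_eq_C233T`, `dSumS_eq_polar`, and the display
`C232S = Re 𝔠₁ + Re 𝔠₂ + 2Re 𝔠₃ˢ`) is re-proved below from the **calculus class**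
`AdmissibleThetaCalc θ := 0 < ν₃ ≤ ν₂ < ν₁ ≤ 1 ∧ k₁ k₂ k₃ ≠ 0` alone (`ι`, `cut₁` free) — the exact
list of inequalities the landed profile lemmas (`kinkedProfile_pairProfile`, `pairForm_eq_mainTermForm`,
`kappaP_one`, `kinkedProfile_tentT`, `mainTermFormPolar_eq_Mform`, `mainTermFormPolar_refl`,
`reflDeriv_tentT'_ae`) consume. Hence, by Cauchy–Schwarz for the ONE positive semidefinite form `𝔅`
(`RepairBarrierAssembly.not_trueNeed_of_domination`):
**`not_repairable_true_need_calc`** on `AdmissibleThetaCalc`, and **`not_repairable_true_need_wide`**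
on the NAMED extension class `AdmissibleThetaWide` = `R` with `ν₂ ≤ ½` and `k₁ = k₃` deleted and every
other conjunct VERBATIM (`orderedLengths`, `ν₃ < ½ < ν₁`, `belowP`, `dualRangesNonempty`, `cutAtHalf`,
`shiftsInContour`) — the class the programme charter names «ν₂ > ½, untied k₃» (LS-PROGRAMME v1.1 §2
row E; barrier/ASSIGNMENTS.md v1 row S-E-p5-1; barrier/REF-E.md §0b row p5); the embeddings
`AdmissibleTheta.toWide : R ⊆ R_wide`, `AdmissibleThetaWide.toCalc : R_wide ⊆ R_calc` (restricted to
`R` the theorem IS `not_repairable_true_need`, restricted through the embedding); non-vacuity and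
strictness witnesses `thetaNuHigh` (`ν = (7/10, 3/5, 9/20)`, `ν₂ > ½`) and `thetaKUntied` (`θ₀` with
`k₃ = 5/2 ≠ 3/2 = k₁`), both in `R_wide \ R`; the extension-protocol objects of `RepairRplus`:
`familyRWide`, `familyRWide_decided`, `rplus_wide_decided : ClassDecided (Rplus ++ [familyRWide])`.
Companion shapes (CS inequality, `√` shape, printed triple, T-zero, ratio, feeder display,
positivity witnesses) are in `RepairAdmissibleWideCompanions`.

## Currency (what the theorems are about, and what they are NOT about)

The conclusions are theorems about the CONTINUED-CALCULUS constants `C232S`/`C233T`/`dSumS` (values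
and polar values of `𝔅 = MainTermFormPSD.mainTermForm` on profiles supported in `[0,1]`; every top
`≤ 1`, reflection length `ℓ = 1`). On `R` these constants are, identity by identity, the manuscript's
own closed forms ((8.23), (9.7), (10.12)–(10.19), (18.1)) — kernel-checked (the p428635 chain). OFF `R`
a design crosses range walls of the §§12–17 route behind the `𝔠₃` slot: a design with `ν₂ > ½` and
`cut₁ = ½` violates (R-a) `cut₁ + max(ν₂,ν₃) ≤ 1` [(14.2)] and (R-d) `cut₁ + ν₂ ≤ 1`
(theory/KS2-DERIVATION.md §D′; OBJECTIVE.md registry row E-017 «E-walls(x)», status OPEN); untying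
`k₃` crosses no range wall ((2.23)/(2.25) merely print one symbol `β₆` for both shifts; the closed forms
are per-factor). Whether the continued calculus is the (A)-world main term across a wall is the open
dictionary item E-017 — these theorems do not decide it and do not claim to («validity off R: E-017
open»; «would it close if E-017 were proved: NO», by the theorems below). Numerical certificates
consumed: none (structural; `𝔅 ⪰ 0` is the theorem `MainTermFormH1.mainTermForm_nonneg_of_isH1`, and no
top form / `F_ℓ` enters since every top is `≤ 1` and `ℓ = 1`).

Reference: Y. Zhang, arXiv:2211.02515v1 (2022), §2 (2.21)–(2.28), Props. 2.4–2.6, (2.32)–(2.33);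
§8 (8.23); §9 (9.7); §10 (10.1), (10.12)–(10.19); §12 (12.1)–(12.2); §14 (14.2); §18 (18.1).
[cite: Zhang2022LandauSiegel, §§2, 8–10, 12, 14, 18]
-/

noncomputable section

open Real Complex ComplexConjugate MeasureTheory Set
open scoped Interval

namespace Literature.NumberTheory.LFunctions.Zhang2022

namespace Repair

variable {θ : Theta}

/-! ### The two relaxed classes -/

/-- `Theta.straddleHalf` with its middle conjunct `ν₂ ≤ 1/2` DELETED: the outer lengths straddle
`P^{1/2}` — `ν₃ < 1/2 < ν₁` — and `ν₂` is free between them (in particular `ν₂ > 1/2` is allowed: the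
factor `H₁₂` of `B = (H₁₄ + ι₂H₁₂)H₂` (12.2) may then be longer than `P^{1/2}`, walls (R-a)/(R-d)).
[cite: Zhang2022LandauSiegel, §12 (12.1)–(12.2)] -/
def Theta.outerStraddleHalf (θ : Theta) : Prop := θ.nu3 < 1 / 2 ∧ 1 / 2 < θ.nu1

/-- **The extension class `R_wide` («ν₂ > ½, untied k₃»)**: `Repair.AdmissibleTheta` with the conjunct
`ν₂ ≤ 1/2` of `straddleHalf` and the tie `tiedOuterShifts : k₁ = k₃` DELETED, every other conjunct
verbatim: `ν₃ < ν₂ < ν₁` (`orderedLengths`), `ν₃ < 1/2 < ν₁` (`outerStraddleHalf`), `ν₁ < 1` (`belowP`),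
`1 < ν₁ + ν₃` (`dualRangesNonempty`), `cut₁ = 1/2` (`cutAtHalf`), `0 < k_j < 5` (`shiftsInContour`,
`k₃` free of `k₁`); `ι ∈ ℂ³` free. Off `R` exactly when `ν₂ > 1/2` (walls (R-a), (R-d) of the §§12–17
route crossed) or `k₁ ≠ k₃` (no wall). [cite: Zhang2022LandauSiegel, §2 (2.21)–(2.26); §12 (12.1)–(12.2); §14 (14.2)] -/
def AdmissibleThetaWide (θ : Theta) : Prop :=
  θ.orderedLengths ∧ θ.outerStraddleHalf ∧ θ.belowP ∧ θ.dualRangesNonempty ∧ θ.cutAtHalf ∧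
    θ.shiftsInContour

/-- **The calculus class `R_calc`**: exactly the side conditions the dictionary identities K-S1–K-S3
consume — `0 < ν₃ ≤ ν₂ < ν₁ ≤ 1` (the three `ϰ`-pieces and the tent are `H¹` profiles supported in
`[0,1]`, the tent window `[ν₂, ν₁]` is non-degenerate) and `k₁, k₂, k₃ ≠ 0` (the `ϰ`-closed forms carry
`k` in denominators); `ι ∈ ℂ³` and `cut₁` free. Every top is `≤ 1` and the reflection length is `1`:
the designs lie in the CS-covered class R̄ of the cell's OBJECTIVE §1.3.
[cite: Zhang2022LandauSiegel, §2 (2.21)–(2.28); §8 (8.13)–(8.18)] -/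
def AdmissibleThetaCalc (θ : Theta) : Prop :=
  0 < θ.nu3 ∧ θ.nu3 ≤ θ.nu2 ∧ θ.nu2 < θ.nu1 ∧ θ.nu1 ≤ 1 ∧ θ.k1 ≠ 0 ∧ θ.k2 ≠ 0 ∧ θ.k3 ≠ 0

/-- **`R ⊆ R_wide`** (the C2 embedding): every admissible design lies in the extension class (drop two
conjuncts). [cite: Zhang2022LandauSiegel, §2 (2.21)–(2.26)] -/
theorem AdmissibleTheta.toWide (h : AdmissibleTheta θ) : AdmissibleThetaWide θ := by
  obtain ⟨ho, ⟨h3, -, h1⟩, hP, hd, hc, hk, -⟩ := h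
  exact ⟨ho, ⟨h3, h1⟩, hP, hd, hc, hk⟩

/-- **`R_wide ⊆ R_calc`**: the extension class satisfies the calculus side conditions
(`0 < ν₃` from `1 < ν₁ + ν₃` and `ν₁ < 1`; `k_j ≠ 0` from `0 < k_j`).
[cite: Zhang2022LandauSiegel, §2 (2.21)–(2.26)] -/
theorem AdmissibleThetaWide.toCalc (h : AdmissibleThetaWide θ) : AdmissibleThetaCalc θ := by
  obtain ⟨⟨h32, h21⟩, ⟨-, -⟩, hP, hd, -, ⟨⟨hk1, -⟩, ⟨hk2, -⟩, ⟨hk3, -⟩⟩⟩ := h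
  unfold Theta.belowP at hP
  unfold Theta.dualRangesNonempty at hd
  exact ⟨by linarith, h32.le, h21, hP.le, hk1.ne', hk2.ne', hk3.ne'⟩

/-- `R ⊆ R_calc`. [cite: Zhang2022LandauSiegel, §2 (2.21)–(2.26)] -/
theorem AdmissibleTheta.toCalc (h : AdmissibleTheta θ) : AdmissibleThetaCalc θ := h.toWide.toCalc

/-! ### Non-vacuity and strictness: two named members of `R_wide \ R` -/

/-- Witness with `ν₂ > 1/2`: `ν = (7/10, 3/5, 9/20)`, printed shifts `k = (3/2, 5/2, 3/2)`, printed `ι`,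
`cut₁ = 1/2` (`ν₃ = 9/20 < 1/2 < 3/5 = ν₂ < 7/10 = ν₁ < 1`, `ν₁ + ν₃ = 23/20 > 1`).
[cite: Zhang2022LandauSiegel, §2 (2.21)–(2.26)] -/
def thetaNuHigh : Theta where
  nu1 := 7 / 10
  nu2 := 3 / 5
  nu3 := 9 / 20
  k1 := 3 / 2
  k2 := 5 / 2
  k3 := 3 / 2
  iota2 := iota2
  iota3 := iota3
  iota4 := iota4
  cut1 := 1 / 2

/-- Witness with untied outer shifts: the printed design `θ₀` except `k₃ = 5/2 ≠ 3/2 = k₁`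
(`H₁₃` carries `β₇` instead of `β₆`). [cite: Zhang2022LandauSiegel, §2 (2.22)–(2.25)] -/
def thetaKUntied : Theta where
  nu1 := 0.504
  nu2 := 0.5
  nu3 := 0.498
  k1 := 3 / 2
  k2 := 5 / 2
  k3 := 5 / 2
  iota2 := iota2
  iota3 := iota3
  iota4 := iota4
  cut1 := 0.5

/-- `thetaNuHigh ∈ R_wide`. [cite: Zhang2022LandauSiegel, §2 (2.21)–(2.26)] -/
theorem admissibleWide_thetaNuHigh : AdmissibleThetaWide thetaNuHigh := by
  unfold AdmissibleThetaWide Theta.orderedLengths Theta.outerStraddleHalf Theta.belowP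
    Theta.dualRangesNonempty Theta.cutAtHalf Theta.shiftsInContour thetaNuHigh
  norm_num

/-- `thetaNuHigh ∉ R` (its `ν₂ = 3/5` violates `ν₂ ≤ 1/2`): the extension is strict on the `ν₂` side.
[cite: Zhang2022LandauSiegel, §12 (12.1)–(12.2)] -/
theorem not_admissible_thetaNuHigh : ¬ AdmissibleTheta thetaNuHigh := by
  rintro ⟨-, ⟨-, h2, -⟩, -⟩
  unfold thetaNuHigh at h2
  norm_num at h2

/-- `thetaKUntied ∈ R_wide`. [cite: Zhang2022LandauSiegel, §2 (2.21)–(2.26)] -/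
theorem admissibleWide_thetaKUntied : AdmissibleThetaWide thetaKUntied := by
  unfold AdmissibleThetaWide Theta.orderedLengths Theta.outerStraddleHalf Theta.belowP
    Theta.dualRangesNonempty Theta.cutAtHalf Theta.shiftsInContour thetaKUntied
  norm_num

/-- `thetaKUntied ∉ R` (its `k₃ = 5/2 ≠ 3/2 = k₁` violates the tie): the extension is strict on the
`k₃` side. [cite: Zhang2022LandauSiegel, §2 (2.23), (2.25)] -/
theorem not_admissible_thetaKUntied : ¬ AdmissibleTheta thetaKUntied := by
  rintro ⟨-, -, -, -, -, -, ht⟩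
  unfold Theta.tiedOuterShifts thetaKUntied at ht
  norm_num at ht

/-- The printed design `θ₀` lies in `R_wide` (through `R`). [cite: Zhang2022LandauSiegel, §2 (2.21)–(2.26)] -/
theorem admissibleWide_theta0 : AdmissibleThetaWide theta0 := admissible_theta0.toWide

/-- The whole printed-exponent `ι`-family lies in `R_wide` (through `R`). [cite: Zhang2022LandauSiegel, §2 (2.21)–(2.26)] -/
theorem admissibleWide_thetaIota (w2 w3 w4 : ℂ) : AdmissibleThetaWide (thetaIota w2 w3 w4) :=
  (admissible_thetaIota w2 w3 w4).toWide

/-! ### The dictionary K-S1–K-S3 re-run on the calculus class (the survivor audit, in the kernel) -/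

/-- `H₁`'s profile `ϰ(ν₁,k₁) + ι₂ϰ(ν₂,k₂)` is a kinked `H¹` profile on `R_calc`.
[cite: Zhang2022LandauSiegel, (2.23), (2.24), (2.27)] -/
theorem kinkedProfile_h1Profile_calc (h : AdmissibleThetaCalc θ) :
    KinkedProfile (h1Profile θ) (h1Profile' θ) := by
  obtain ⟨h3, h32, h21, h1, -, -, -⟩ := h
  exact kinkedProfile_pairProfile (h3.trans_le h32) h21.le h1 1 θ.iota2

/-- `H₂`'s profile `ῑ₄ϰ(ν₂,k₂) + ῑ₃ϰ(ν₃,k₃)` is a kinked `H¹` profile on `R_calc`.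
[cite: Zhang2022LandauSiegel, (2.24), (2.25), (2.27)] -/
theorem kinkedProfile_h2Profile_calc (h : AdmissibleThetaCalc θ) :
    KinkedProfile (h2Profile θ) (h2Profile' θ) := by
  obtain ⟨h3, h32, h21, h1, -, -, -⟩ := h
  exact kinkedProfile_pairProfile h3 h32 (h21.le.trans h1) (conj θ.iota4) (conj θ.iota3)

/-- **`hgl` survives**: the glued design profile `𝔤_θ = g₁ + R̃g₂` is `H¹` on `R_calc`.
[cite: Zhang2022LandauSiegel, §2 (2.27), (2.32)] -/
theorem glued_isH1_on_calc : ∀ θ, AdmissibleThetaCalc θ → IsH1OnUnitInterval (gluedS θ) (gluedS' θ) :=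
  fun _ h => (kinkedProfile_h1Profile_calc h).isH1.add_refl (kinkedProfile_h2Profile_calc h).isH1

/-- **`hfp` survives**: the tent `f_θ` on `[ν₂, ν₁]` is `H¹` on `R_calc` (`ν₂ < ν₁` only).
[cite: Zhang2022LandauSiegel, §2 (2.28)] -/
theorem tent_isH1_on_calc : ∀ θ, AdmissibleThetaCalc θ → IsH1OnUnitInterval (tentT θ) (tentT' θ) :=
  fun _ h => isH1_tentT h.2.2.1

/-- **`h232` survives** (K-S2, definitional): `C232S θ = 𝔅(𝔤_θ)` — no side condition at all.
[cite: Zhang2022LandauSiegel, §18 (18.1), (2.32)] -/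
theorem h232_on_calc : ∀ θ, AdmissibleThetaCalc θ → C232S θ = mainTermForm (gluedS θ) (gluedS' θ) :=
  fun θ _ => C232S_eq_form θ

/-- **`h233` survives** (K-S1, tent): `C233T θ = 𝔅(f_θ)` on `R_calc` (`0 ≤ ν₂ < ν₁ ≤ 1`).
[cite: Zhang2022LandauSiegel, §10 (10.19), §18 (18.3), (2.33)] -/
theorem h233_on_calc : ∀ θ, AdmissibleThetaCalc θ → C233T θ = mainTermForm (tentT θ) (tentT' θ) := by
  intro θ h
  obtain ⟨h3, h32, h21, h1, -, -, -⟩ := h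
  exact (mainTermForm_tentT_eq_C233T h21 (by linarith) h1).symm

/-- K-S3, `𝔡`-block on `R_calc`: `dSum1S θ = P(g₁, f)` (one-sided Gram identity, `g₁(1) = f(1) = 0`).
[cite: Zhang2022LandauSiegel, §10 (10.1), (10.12)–(10.13), (10.17)] -/
theorem dSum1S_eq_polar_calc (h : AdmissibleThetaCalc θ) :
    dSum1S θ = mainTermFormPolar (h1Profile θ) (h1Profile' θ) (tentT θ) (tentT' θ) := by
  have hg := kinkedProfile_h1Profile_calc h
  obtain ⟨h3, h32, h21, h1, -, -, -⟩ := h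
  have hf := kinkedProfile_tentT h21
  have hg1 : h1Profile θ 1 = 0 := by
    unfold h1Profile pairProfile
    rw [kappaP_one (by linarith) h1, kappaP_one (by linarith) (h21.le.trans h1)]; ring
  have hf1 : tentT θ 1 = 0 := tentT_of_hi_le h21 h1
  rw [mainTermFormPolar_eq_Mform hg hf hg1 hf1]; rfl

/-- K-S3, the one-sided Gram identity for the reflected-tent block on `R_calc`: `P(f₂, g₂) = dSum2S θ`.
[cite: Zhang2022LandauSiegel, §10 (10.1), (10.14)–(10.16)] -/
theorem polar_rtent_h2_eq_calc (h : AdmissibleThetaCalc θ) :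
    mainTermFormPolar (tentT θ.reflectJ) (tentT' θ.reflectJ) (h2Profile θ) (h2Profile' θ) = dSum2S θ := by
  have hg := kinkedProfile_h2Profile_calc h
  obtain ⟨h3, h32, h21, h1, -, -, -⟩ := h
  have hf := kinkedProfile_tentT (reflectJ_lt h21)
  have hg1 : h2Profile θ 1 = 0 := by
    unfold h2Profile pairProfile
    rw [kappaP_one (by linarith) (h21.le.trans h1), kappaP_one h3 (by linarith)]; ring
  have hf1 : tentT θ.reflectJ 1 = 0 :=
    tentT_of_hi_le (reflectJ_lt h21) (by simp only [reflectJ_nu1]; linarith)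
  rw [mainTermFormPolar_eq_Mform hf hg hf1 hg1]; rfl

/-- K-S3, `𝔡′`-block on `R_calc`: `dSum2S θ = P(R̃g₂, f)` (antiunitarity of `P` under the
functional-equation reflection; the companion `R̃′f′` differs from the reflected tent's right derivative
only on the three kinks). [cite: Zhang2022LandauSiegel, §10 (10.1), (10.14)–(10.17); §12 (12.6)–(12.8)] -/
theorem dSum2S_eq_polar_calc (h : AdmissibleThetaCalc θ) :
    dSum2S θ = mainTermFormPolar (reflProfile (h2Profile θ)) (reflDeriv (h2Profile' θ))
      (tentT θ) (tentT' θ) := by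
  have hgc : ContinuousOn (h2Profile θ) (Icc 0 1) := (kinkedProfile_h2Profile_calc h).cont
  have hpol := polar_rtent_h2_eq_calc h
  obtain ⟨h3, h32, h21, h1, -, -, -⟩ := h
  have hfc : ContinuousOn (tentT θ.reflectJ) (Icc 0 1) := (continuous_tentT _).continuousOn
  have hrefl := mainTermFormPolar_refl hgc hfc (h2Profile' θ) (tentT' θ.reflectJ)
  rw [reflProfile_tentT_reflectJ] at hrefl
  have hae : ∀ᵐ x ∂volume, x ∈ Ι (0:ℝ) 1 → reflDeriv (tentT' θ.reflectJ) x = tentT' θ x := by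
    have h' := reflDeriv_tentT'_ae (reflectJ_lt h21)
    rw [Theta.reflectJ_reflectJ] at h'; exact h'
  rw [mainTermFormPolar_congr_ae hae] at hrefl
  rw [hrefl, ← mainTermFormPolar_swap, hpol]

/-- **`hsum` survives** (K-S3): `dSumS θ = P(𝔤_θ, f_θ)` on `R_calc`.
[cite: Zhang2022LandauSiegel, §2 (2.17)–(2.18); §10 (10.1), (10.17)] -/
theorem hsum_on_calc : ∀ θ, AdmissibleThetaCalc θ →
    dSumS θ = mainTermFormPolar (gluedS θ) (gluedS' θ) (tentT θ) (tentT' θ) := by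
  intro θ h
  have k1 := kinkedProfile_h1Profile_calc h
  have k2 := kinkedProfile_h2Profile_calc h
  have e1 := dSum1S_eq_polar_calc h
  have e2 := dSum2S_eq_polar_calc h
  obtain ⟨-, -, h21, -, -, -, -⟩ := h
  show dSum1S θ + dSum2S θ =
    mainTermFormPolar (fun y => h1Profile θ y + reflProfile (h2Profile θ) y)
      (fun y => h1Profile' θ y + reflDeriv (h2Profile' θ) y) (tentT θ) (tentT' θ)
  rw [polar_add_refl_left k1.isH1 k2.isH1 (isH1_tentT h21), e1, e2]

/-- K-S1 on `R_calc`: `𝔠₁T(θ) = 𝔅(g₁)` (the pair-form identity; `k₁, k₂ ≠ 0`).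
[cite: Zhang2022LandauSiegel, §8 (8.23) p.50] -/
theorem frakc1T_eq_mainTermForm_calc (h : AdmissibleThetaCalc θ) :
    frakc1T θ = (mainTermForm (h1Profile θ) (h1Profile' θ) : ℂ) := by
  obtain ⟨h3, h32, h21, h1, hk1, hk2, -⟩ := h
  exact pairForm_eq_mainTermForm (h3.trans_le h32) h21.le h1 hk1 hk2 1 θ.iota2

/-- K-S1 on `R_calc`: `𝔠₂T(θ) = 𝔅(g₂)` (`k₂, k₃ ≠ 0`; the tie `k₁ = k₃` is never used).
[cite: Zhang2022LandauSiegel, §9 (9.7) p.52] -/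
theorem frakc2T_eq_mainTermForm_calc (h : AdmissibleThetaCalc θ) :
    frakc2T θ = (mainTermForm (h2Profile θ) (h2Profile' θ) : ℂ) := by
  obtain ⟨h3, h32, h21, h1, -, hk2, hk3⟩ := h
  exact pairForm_eq_mainTermForm h3 h32 (h21.le.trans h1) hk2 hk3 (conj θ.iota4) (conj θ.iota3)

/-- K-S2 block expansion on `R_calc`: `C232S θ = 𝔅(g₁) + 𝔅(g₂) + 2 Re 𝔠₃ˢ(θ)`.
[cite: Zhang2022LandauSiegel, §8 (8.2); §18 (18.1)] -/
theorem C232S_eq_blocks_calc (h : AdmissibleThetaCalc θ) :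
    C232S θ = mainTermForm (h1Profile θ) (h1Profile' θ) + mainTermForm (h2Profile θ) (h2Profile' θ)
      + 2 * (frakc3S θ).re :=
  mainTermForm_add_refl (kinkedProfile_h1Profile_calc h).isH1 (kinkedProfile_h2Profile_calc h).isH1

/-- **The dictionary of `C₂₃₂ = 𝔠₁ + 𝔠₂ + 2Re 𝔠₃` on `R_calc`**:
`C232S θ = Re 𝔠₁T(θ) + Re 𝔠₂T(θ) + 2 Re 𝔠₃ˢ(θ)`. [cite: Zhang2022LandauSiegel, §8 (8.2), (8.23), (9.7); §18 (18.1)] -/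
theorem C232S_eq_frakc_calc (h : AdmissibleThetaCalc θ) :
    C232S θ = (frakc1T θ).re + (frakc2T θ).re + 2 * (frakc3S θ).re := by
  rw [C232S_eq_blocks_calc h, frakc1T_eq_mainTermForm_calc h, frakc2T_eq_mainTermForm_calc h,
    Complex.ofReal_re, Complex.ofReal_re]

/-! ### The verdict on the calculus class and on the named extension class -/

/-- **NOT-REPAIRABLE on `R_calc`** (continued-calculus currency): for every design with
`0 < ν₃ ≤ ν₂ < ν₁ ≤ 1`, `k₁ k₂ k₃ ≠ 0`, any `ι ∈ ℂ³`, any `cut₁`, the joint main-order criterion of the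
§2 endgame fails, `¬ (C₂₃₂(θ)·C₂₃₃(θ) < |𝔡+𝔡′|²(θ))` — Cauchy–Schwarz for the one positive semidefinite
form `𝔅` (`RepairBarrierAssembly.not_trueNeed_of_domination`) with the five dictionary hypotheses
discharged above. Validity of the continued calculus off `R`: registry item E-017, open.
[cite: Zhang2022LandauSiegel, §2 Props. 2.4–2.6, (2.32)–(2.33)] -/
theorem not_repairable_true_need_calc :
    ∀ θ, AdmissibleThetaCalc θ → ¬ (C232S θ * C233T θ < ‖dSumS θ‖ ^ 2) :=
  not_trueNeed_of_domination glued_isH1_on_calc tent_isH1_on_calc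
    (fun θ h => (h232_on_calc θ h).symm.le) (fun θ h => (h233_on_calc θ h).symm.le)
    (fun θ h => (hsum_on_calc θ h).symm ▸ le_rfl)

/-- **NOT-REPAIRABLE-IN-CLASS, EXTENDED TO `R_wide`.** For every design `θ` of `AdmissibleThetaWide`
(= `AdmissibleTheta` with `ν₂ ≤ 1/2` and `k₁ = k₃` deleted: `ν₃ < ν₂ < ν₁ < 1`, `ν₃ < 1/2 < ν₁`,
`ν₁ + ν₃ > 1`, `cut₁ = 1/2`, `0 < k₁, k₂, k₃ < 5` independent, `ι ∈ ℂ³` free) the joint main-order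
criterion of the §2 endgame fails in the continued-calculus currency:
`¬ (C232S θ · C233T θ < ‖dSumS θ‖²)`. All five dictionary hypotheses of `RepairVerdictAssembly`
survive on the class (re-proved: `glued_isH1_on_calc`, `tent_isH1_on_calc`, `h232_on_calc`,
`h233_on_calc`, `hsum_on_calc`), so NO hypothesis is displayed. On `R` this IS
`RepairVerdictAssembly.not_repairable_true_need` (restrict through `AdmissibleTheta.toWide`); the members
`thetaNuHigh` (`ν₂ = 3/5`), `thetaKUntied` (`k₃ ≠ k₁`) show the extension is strict on both sides. Off `R`
(a member with `ν₂ > 1/2` crosses walls (R-a), (R-d) of the §§12–17 route; `k₁ ≠ k₃` crosses none) the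
identification of these constants with the (A)-world main terms is registry item E-017, open — not
claimed here. [cite: Zhang2022LandauSiegel, §2 Props. 2.4–2.6, (2.32)–(2.33); §12 (12.1)–(12.2); §14 (14.2)] -/
theorem not_repairable_true_need_wide :
    ∀ θ, AdmissibleThetaWide θ → ¬ (C232S θ * C233T θ < ‖dSumS θ‖ ^ 2) :=
  fun θ h => not_repairable_true_need_calc θ h.toCalc

/-- At the `ν₂ = 3/5 > 1/2` design the §2 endgame does not close at main order (continued calculus).
[cite: Zhang2022LandauSiegel, §2 Props. 2.4–2.6, (2.32)–(2.33)] -/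
theorem not_repairable_thetaNuHigh :
    ¬ (C232S thetaNuHigh * C233T thetaNuHigh < ‖dSumS thetaNuHigh‖ ^ 2) :=
  not_repairable_true_need_wide _ admissibleWide_thetaNuHigh

/-- At the untied design `k = (3/2, 5/2, 5/2)` the §2 endgame does not close at main order.
[cite: Zhang2022LandauSiegel, §2 Props. 2.4–2.6, (2.32)–(2.33)] -/
theorem not_repairable_thetaKUntied :
    ¬ (C232S thetaKUntied * C233T thetaKUntied < ‖dSumS thetaKUntied‖ ^ 2) :=
  not_repairable_true_need_wide _ admissibleWide_thetaKUntied

/-! ### Extension protocol of `RepairRplus`: the families and `R⁺ ++ [familyRWide]` decided -/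

/-- family `R_wide` (T-true continued-calculus currency; no conditional input, nothing displayed).
[cite: Zhang2022LandauSiegel, §2 (2.32)–(2.33)] -/
def familyRWide : DesignFamily where
  Design := Theta
  InClass := AdmissibleThetaWide
  Verdict θ := ¬ (C232S θ * C233T θ < ‖dSumS θ‖ ^ 2)

/-- family `R_calc` (the same currency on the calculus class). [cite: Zhang2022LandauSiegel, §2 (2.32)–(2.33)] -/
def familyRCalc : DesignFamily where
  Design := Theta
  InClass := AdmissibleThetaCalc
  Verdict θ := ¬ (C232S θ * C233T θ < ‖dSumS θ‖ ^ 2)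

/-- `familyRWide` is decided. [cite: Zhang2022LandauSiegel, §2 (2.32)–(2.33)] -/
theorem familyRWide_decided : familyRWide.Decided := not_repairable_true_need_wide

/-- `familyRCalc` is decided. [cite: Zhang2022LandauSiegel, §2 (2.32)–(2.33)] -/
theorem familyRCalc_decided : familyRCalc.Decided := not_repairable_true_need_calc

/-- `familyR`'s members are `familyRWide`'s members (same design type, same verdict, wider class) — the
C2 embedding at the family level. [cite: Zhang2022LandauSiegel, §2 (2.32)–(2.33)] -/
theorem familyR_inClass_toWide (θ : Theta) (h : familyR.InClass θ) : familyRWide.InClass θ :=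
  AdmissibleTheta.toWide h

/-- **`R⁺ ++ [familyRWide]` is decided** (`RepairRplus.rplus_extend`): the running class of record gains
the «ν₂ > ½, untied k₃» family. [cite: Zhang2022LandauSiegel, §2 (2.32)–(2.33)] -/
theorem rplus_wide_decided : ClassDecided (Rplus ++ [familyRWide]) := rplus_extend familyRWide_decided

end Repair

end Literature.NumberTheory.LFunctions.Zhang2022
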